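import Summits.QuantumFields.BalabanUV.T4Continuum.Spine.NE2ColourPerturbedLayer

/-!
# T⁴ programme, spine node NE2 (U1a), tier B — the NAMED TARGET SHAPES of the formalisation swarm (typer's statement stub)

Typer unit `b2b-balaban-t4-ne2-formalise-typer` of the NE2 formalisation swarm `t4-ne2-formalise-*` (cell `pub-balaban`), cut from the
acknowledged skeleton `t4/SKELETON-NE2-P1.md` v0.2 (owner lineage t4-ne2-p1; trigger `t4/T4-NE2-TRIGGER.json`, t4-ref2 pass 58) and recorded
in `t4/formal/NE2/DAG.md` (node T) and `t4/formal/NE2/LEAVES.md` (row T).  THIS FILE PROVES NOTHING NEW and ASSERTS NOTHING: it gives ONE NAME each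
to the two statement shapes every tier-B row of the swarm concludes or feeds, plus their bookkeeping — so that the rows' end theorems, the assembly
(row B7) and the referee's probe can be read against a single kernel-checked target.  Everything is a parametric DEFINITION of a proposition
(`[shape]`) or a proved one-line consequence of landed theorems (`[bookkeeping]`); no `def … : Prop` FACT is minted, no printed statement is used as
a hypothesis, the dictionary B0 («`calDalev ⊗ₖ 1 + P_B(U)` = [B9] (3.23)–(3.26) entry-wise») is NOT asserted (trigger c5).

* `TierBLaws L M a ha P κ C₂` [shape] — THE ONE TARGET SHAPE of tier B: `BackgroundResolventTower.PerturbationLaws` (p205614: the three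
  typed inequalities (H-bd)×2, (H-cons); NO limit, NO rate sum) for Bałaban's free operators lifted to the colour layer,
  `D k = calDalev L M a ha k ⊗ₖ 1`, King's planting `J k = JpcT L M k ⊗ₖ 1`, a perturbation tower `P k` on `idx L M k × o`, constant `κ` and
  geometric consistency errors `C₂·L^{−k}`.  LANDED instance: row B2, `ColourCovariantLaplacian.perturbationLaws_colourCovariantLaplacian`
  (p207223) — restated BY NAME as `tierBLaws_covariantLaplacian`.  Rows B3.b∕B4.b conclude it for their summands; `tierBLaws_add₃` is the
  shape of row B7's `perturbationLaws_balaban`.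
* `RootB L M a ha P κ C₂ t` [shape] — ROOT B at coupling `t`: `CovariantAveragingTower.TowerLimitRate` for the King-averaged colour-lifted
  unit-lattice covariances of `(calDalev k ⊗ₖ 1 + t • P k)⁻¹` with the explicit constant `Cpert κ (2d·Cst) CJ C₂ 0 t` and ratio `L⁻¹` — the
  conclusion, LITERALLY, of row B7 PART 1's `NE2ColourPerturbedLayer.towerLimitRate_perturbed_king_kron` (leaf-08, p207727), whose hypothesis
  is LITERALLY `TierBLaws`: `rootB_of_tierBLaws` and `stations_of_tierBLaws` (named limit `pertLimC`, rate, NE2-LIP, holomorphy on the Neumann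
  disc = `ne2Plus_resolvent_route_kron`) are those landed theorems BY NAME — nothing is re-derived here.

HONEST FRAMING: finite torus, linear (Gaussian) layer, operator norm, King's piecewise-constant pairing; constants OURS (explicit tree
definitions); tier B is OPEN: closing every swarm row gives ROOT B for the typed operator `calDalev ⊗ₖ 1 + P_B(U)` CONDITIONAL on node NE3's
`T4EtaRateMin.LocalRate` BY NAME (trigger c2, referee c7) and on the printed regularity class as a hypothesis STRUCTURE on data (c3), under the
carver's scope ruling (c1); NOT [B9] (3.23)–(3.26) as printed; NE2 NOT proved; NOT infinite volume ∕ mass gap ∕ Clay; spine PROVED 0/9 unchanged.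
HONEST DEPENDENCY: continuum YM on T⁴ ⇐ BetaPertH ∧ nine spine estimates (0/9 proved); BetaPertH ⇐ (D1) ∧ (D4) ∧ CAP+tail; G-an2-4 gates asym,
D1 and NE2/3/4.

References (shapes only, nothing printed is a hypothesis): [Balaban1985BackgroundPropagators] = [B9], CMP 99 (1985) 389–434, (3.23)–(3.26)
pp.394–395; [Balaban1984PropagatorsI] = [B5], (1.69) p.29 (`calDa`); [King1986], Lemma 4.5 (the scalar η-rate shape).
-/

noncomputable section

open scoped BigOperators ComplexConjugate Matrix Matrix.Norms.L2Operator Kronecker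
open Filter Topology

namespace Summit.QuantumFields.BalabanUV.T4Continuum.NE2.Targets

open Literature.MathematicalPhysics.QuantumFieldTheory.Balaban1983to89.B5Prop11Plancherel
open Literature.MathematicalPhysics.QuantumFieldTheory.Balaban1983to89.B5G183RateUnitTower (lev lev_neZero)
open Summit.QuantumFields.BalabanUV.T4Continuum
open Summit.QuantumFields.BalabanUV.T4Continuum.CovariantAveragingTower (TowerLimitRate)
open Summit.QuantumFields.BalabanUV.T4Continuum.BalabanAveragedTowerUnit (idx Qlev)
open Summit.QuantumFields.BalabanUV.T4Continuum.BackgroundResolventTower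
open Summit.QuantumFields.BalabanUV.T4Continuum.KingPairingPlantedLaw
open Summit.QuantumFields.BalabanUV.T4Continuum.NE2PerturbedLayer
open Summit.QuantumFields.BalabanUV.T4Continuum.FirstOrderBackgroundModel
open Summit.QuantumFields.BalabanUV.T4Continuum.PerturbationAlgebra
open Summit.QuantumFields.BalabanUV.T4Continuum.KroneckerLift
open Summit.QuantumFields.BalabanUV.T4Continuum.ColourCovariantLaplacian
open Summit.QuantumFields.BalabanUV.T4Continuum.NE2ColourPerturbedLayer

variable {d : ℕ} {o : Type*} [Fintype o] [DecidableEq o]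
variable (L : ℕ) [NeZero L] (M : Fin d → ℕ) [hM : ∀ μ, NeZero (M μ)] (a : ℝ) (ha : 0 < a)

/-! ## §1 The two named shapes -/

/-- [shape] **THE ONE TARGET SHAPE OF TIER B**: the perturbation laws (H-bd)×2 + (H-cons) of `BackgroundResolventTower.PerturbationLaws` for the
colour-lifted free tower `Δ_a^{(k)} ⊗ 1`, King's planting `J_k ⊗ 1`, the perturbation tower `P`, size constant `κ` and consistency errors `C₂·L^{−k}`.
A parametric definition of a proposition — NOT a fact. [folklore] -/
def TierBLaws (P : (k : ℕ) → Matrix (idx L M k × o) (idx L M k × o) ℂ) (κ C₂ : ℝ) : Prop :=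
  PerturbationLaws (fun k => calDalev L M a ha k ⊗ₖ (1 : Matrix o o ℂ)) P (fun k => JpcT L M k ⊗ₖ (1 : Matrix o o ℂ)) κ
    (fun k => C₂ * ((L : ℝ)⁻¹) ^ k)

/-- [shape] **ROOT B AT COUPLING `t`**: the King-averaged colour-lifted unit-lattice covariances of `(Δ_a^{(k)} ⊗ 1 + t·P_k)⁻¹` converge with
rate `L^{−k}` and the explicit constant `Cpert κ (2d·Cst) CJ C₂ 0 t` (`TowerLimitRate`: ∃ limit, `Tendsto` ∧ `‖avgTow k − lim‖ ≤ C·ρ^k∕(1 − ρ)`).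
A parametric definition of a proposition — NOT a fact. [folklore] -/
def RootB (P : (k : ℕ) → Matrix (idx L M k × o) (idx L M k × o) ℂ) (κ C₂ : ℝ) (t : ℂ) : Prop :=
  TowerLimitRate (fun k => Qlev L M k ⊗ₖ (1 : Matrix o o ℂ)) ((L : ℝ) ^ d)
    (fun k => (calDalev L M a ha k ⊗ₖ (1 : Matrix o o ℂ) + t • P k)⁻¹)
    (Cpert κ (2 * d * Cst d a) (CJ d a) C₂ 0 t) ((L : ℝ)⁻¹)

/-- [bookkeeping] `TierBLaws` is the raw `PerturbationLaws` shape, definitionally. [folklore] -/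
theorem tierBLaws_iff (P : (k : ℕ) → Matrix (idx L M k × o) (idx L M k × o) ℂ) (κ C₂ : ℝ) :
    TierBLaws L M a ha P κ C₂ ↔
      PerturbationLaws (fun k => calDalev L M a ha k ⊗ₖ (1 : Matrix o o ℂ)) P (fun k => JpcT L M k ⊗ₖ (1 : Matrix o o ℂ)) κ
        (fun k => C₂ * ((L : ℝ)⁻¹) ^ k) :=
  Iff.rfl

/-- [bookkeeping] `RootB` at the physical value `t = 1` is the `TowerLimitRate` of `(Δ_a^{(k)} ⊗ 1 + P_k)⁻¹`. [folklore] -/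
theorem rootB_one_iff (P : (k : ℕ) → Matrix (idx L M k × o) (idx L M k × o) ℂ) (κ C₂ : ℝ) :
    RootB L M a ha P κ C₂ 1 ↔
      TowerLimitRate (fun k => Qlev L M k ⊗ₖ (1 : Matrix o o ℂ)) ((L : ℝ) ^ d)
        (fun k => (calDalev L M a ha k ⊗ₖ (1 : Matrix o o ℂ) + P k)⁻¹)
        (Cpert κ (2 * d * Cst d a) (CJ d a) C₂ 0 1) ((L : ℝ)⁻¹) := by
  simp only [RootB, one_smul]

/-! ## §2 The cone (row B7's assembly shape) -/

section Cone

variable {P P₁ P₂ P₃ : (k : ℕ) → Matrix (idx L M k × o) (idx L M k × o) ℂ} {κ κ' κ₁ κ₂ κ₃ C C' C₁ C₂ C₃ : ℝ}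

/-- [bookkeeping] sums: constants add (`perturbationLaws_add`). [folklore] -/
theorem tierBLaws_add (h₁ : TierBLaws L M a ha P₁ κ₁ C₁) (h₂ : TierBLaws L M a ha P₂ κ₂ C₂) :
    TierBLaws L M a ha (fun k => P₁ k + P₂ k) (κ₁ + κ₂) (C₁ + C₂) :=
  perturbationLaws_mono (perturbationLaws_add h₁ h₂) le_rfl fun _ => (add_mul C₁ C₂ _).ge

/-- [bookkeeping] three summands — the shape of row B7 (`covPertC + P^∂ + P^Q`). [folklore] -/
theorem tierBLaws_add₃ (h₁ : TierBLaws L M a ha P₁ κ₁ C₁) (h₂ : TierBLaws L M a ha P₂ κ₂ C₂) (h₃ : TierBLaws L M a ha P₃ κ₃ C₃) :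
    TierBLaws L M a ha (fun k => P₁ k + P₂ k + P₃ k) (κ₁ + κ₂ + κ₃) (C₁ + C₂ + C₃) :=
  tierBLaws_add L M a ha (tierBLaws_add L M a ha h₁ h₂) h₃

/-- [bookkeeping] scalar multiples (`perturbationLaws_smul`). [folklore] -/
theorem tierBLaws_smul (c : ℂ) (h : TierBLaws L M a ha P κ C) :
    TierBLaws L M a ha (fun k => c • P k) (‖c‖ * κ) (‖c‖ * C) :=
  perturbationLaws_mono (perturbationLaws_smul c h) le_rfl fun _ => (mul_assoc ‖c‖ C _).symm.le

/-- [bookkeeping] monotonicity in the constants (`perturbationLaws_mono`). [folklore] -/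
theorem tierBLaws_mono (h : TierBLaws L M a ha P κ C) (hκ : κ ≤ κ') (hC : C ≤ C') : TierBLaws L M a ha P κ' C' :=
  perturbationLaws_mono h hκ fun k => mul_le_mul_of_nonneg_right hC (pow_nonneg (inv_nonneg.mpr (Nat.cast_nonneg L)) k)

/-- [bookkeeping] the zero perturbation (`U = 1`: every tier-B summand vanishes BY CONSTRUCTION). [folklore] -/
theorem tierBLaws_zero : TierBLaws L M a ha (fun k => (0 : Matrix (idx L M k × o) (idx L M k × o) ℂ)) 0 0 :=
  perturbationLaws_mono perturbationLaws_zero le_rfl fun _ => (zero_mul _).symm.le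

end Cone

/-! ## §3 The landed instance (row B2) BY NAME -/

/-- [bookkeeping] row B2 IS an instance of the target shape: the non-abelian covariant-Laplacian coupling `Δ^{R_k} − Δ^1 ⊗ 1`
(`ColourCovariantLaplacian.perturbationLaws_colourCovariantLaplacian`, p207223), restated BY NAME. [folklore] -/
theorem tierBLaws_covariantLaplacian (hd : 1 ≤ d) {R : (k : ℕ) → Fin d → (idx L M k → Matrix o o ℂ)} {α β α' β' : ℝ}
    (hV : ∀ p : o × o, LipschitzBackground L M (Vab L M R p) α β) (hz : ∀ p : o × o, BoundedBackground L M (Zab L M R p) α' β') :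
    TierBLaws L M a ha (covPertC L M R) (kappaCol o d a α β α') (C2col o d L a α β β') :=
  perturbationLaws_colourCovariantLaplacian L M a ha hd hV hz

/-! ## §4 ROOT B ⇐ the target shape (the resolvent route's composition on the colour layer) -/

/-- [bookkeeping] **ROOT B ⇐ ONE INSTANCE OF THE TARGET SHAPE** (`L ≥ 2`, `‖t‖κ < 1`) — row B7 PART 1's
`NE2ColourPerturbedLayer.towerLimitRate_perturbed_king_kron` (p207727) BY NAME: its hypothesis is `TierBLaws` and its conclusion is `RootB`,
both literally. [folklore] -/
theorem rootB_of_tierBLaws (hL : 2 ≤ L) {P : (k : ℕ) → Matrix (idx L M k × o) (idx L M k × o) ℂ} {κ C₂ : ℝ}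
    (h : TierBLaws L M a ha P κ C₂) {t : ℂ} (ht : ‖t‖ * κ < 1) : RootB L M a ha P κ C₂ t :=
  towerLimitRate_perturbed_king_kron L M a ha hL h ht

/-- [bookkeeping] **EVERY STATION ⇐ ONE INSTANCE OF THE TARGET SHAPE** — row B7 PART 1's `ne2Plus_resolvent_route_kron` (p207727) BY NAME:
named limit `pertLimC` with `Tendsto` at `t` and at `0`, the rate `Cpert·L^{−k}/(1 − L^{−1})`, NE2-LIP `‖c_∞(t) − c_∞(0)‖ ≤ ‖t‖κ·Cst·(1 − ‖t‖κ)⁻¹`,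
holomorphy of `pertLimC` on the Neumann disc `‖t‖κ < 1`. [folklore] -/
theorem stations_of_tierBLaws (hL : 2 ≤ L) {P : (k : ℕ) → Matrix (idx L M k × o) (idx L M k × o) ℂ} {κ C₂ : ℝ}
    (h : TierBLaws L M a ha P κ C₂) {t : ℂ} (ht : ‖t‖ * κ < 1) :
    Tendsto (pertCovC L M a ha P t) atTop (𝓝 (pertLimC L M a ha P t)) ∧
      Tendsto (pertCovC L M a ha P 0) atTop (𝓝 (pertLimC L M a ha P 0)) ∧
      (∀ k, ‖pertCovC L M a ha P t k - pertLimC L M a ha P t‖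
          ≤ Cpert κ (2 * d * Cst d a) (CJ d a) C₂ 0 t * ((L : ℝ)⁻¹) ^ k / (1 - (L : ℝ)⁻¹)) ∧
      ‖pertLimC L M a ha P t - pertLimC L M a ha P 0‖ ≤ ‖t‖ * κ * Cst d a * (1 - ‖t‖ * κ)⁻¹ ∧
      DifferentiableOn ℂ (pertLimC L M a ha P) {t : ℂ | ‖t‖ * κ < 1} :=
  ne2Plus_resolvent_route_kron L M a ha hL h ht

/-- [bookkeeping] the physical value `t = 1` in the small-field regime `κ < 1` (the threshold is DISPLAYED, not assumed abstractly).
[folklore] -/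
theorem rootB_at_one (hL : 2 ≤ L) {P : (k : ℕ) → Matrix (idx L M k × o) (idx L M k × o) ℂ} {κ C₂ : ℝ}
    (h : TierBLaws L M a ha P κ C₂) (hκ : κ < 1) : RootB L M a ha P κ C₂ 1 :=
  rootB_of_tierBLaws L M a ha hL h (by rwa [norm_one, one_mul])

/-- [bookkeeping] **ROW B7's SHAPE**: three summand laws give ROOT B for the sum, for `‖t‖(κ₁ + κ₂ + κ₃) < 1`. [folklore] -/
theorem rootB_of_three (hL : 2 ≤ L) {P₁ P₂ P₃ : (k : ℕ) → Matrix (idx L M k × o) (idx L M k × o) ℂ} {κ₁ κ₂ κ₃ C₁ C₂ C₃ : ℝ}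
    (h₁ : TierBLaws L M a ha P₁ κ₁ C₁) (h₂ : TierBLaws L M a ha P₂ κ₂ C₂) (h₃ : TierBLaws L M a ha P₃ κ₃ C₃) {t : ℂ}
    (ht : ‖t‖ * (κ₁ + κ₂ + κ₃) < 1) :
    RootB L M a ha (fun k => P₁ k + P₂ k + P₃ k) (κ₁ + κ₂ + κ₃) (C₁ + C₂ + C₃) t :=
  rootB_of_tierBLaws L M a ha hL (tierBLaws_add₃ L M a ha h₁ h₂ h₃) ht

/-- SANITY (definitional agreement with the tree): row B2's landed η-rate `towerLimitRate_colourCovariantLaplacian` is LITERALLY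
`RootB` for `P = covPertC L M R`. -/
example (hL : 2 ≤ L) (hd : 1 ≤ d) {R : (k : ℕ) → Fin d → (idx L M k → Matrix o o ℂ)} {α β α' β' : ℝ}
    (hV : ∀ p : o × o, LipschitzBackground L M (Vab L M R p) α β) (hz : ∀ p : o × o, BoundedBackground L M (Zab L M R p) α' β')
    {t : ℂ} (ht : ‖t‖ * kappaCol o d a α β α' < 1) :
    RootB L M a ha (covPertC L M R) (kappaCol o d a α β α') (C2col o d L a α β β') t :=
  towerLimitRate_colourCovariantLaplacian L M a ha hL hd hV hz ht

end Summit.QuantumFields.BalabanUV.T4Continuum.NE2.Targets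

end
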